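import Summits.AnomalousDissipation.AnomalousDissipation.Theorems.BaireTransferRobustLoudUpgradeLine
import Summits.AnomalousDissipation.AnomalousDissipation.Theorems.DenseLoudDesignerForces.Negative.WindowBounds
import Literature.Analysis.FluidPDE.SteadyNavierStokesProofs
import Literature.Analysis.FluidPDE.SteadyNavierStokesEnergy
import Literature.Analysis.FluidPDE.SteadyNavierStokesRegularity
import Literature.Analysis.FluidPDE.CylindricalGenerator
import Literature.Analysis.FluidPDE.LongTimeAveragePeriodic
import Literature.Analysis.FunctionSpaces.TorusLerayHelmholtzProofs
import Literature.Analysis.FunctionSpaces.TorusClassicalNSUniqueness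

/-!
# Stub `stub_censusInterior` of the line `malkin-cone-group-orbits` (crux stmt-AnomalousDissipation-1144)

The nondegeneracy-free persistence theorem of the line: `censusSteady S a E ε ⊆ interior (loud S a E ε)`.
If at ONE viscosity `ν ∈ (0,a)` every mean-zero classical steady state of `NS_ν(f_c)` has strict budgets
(`meanEnergy < E`, `meanDissipation > ε`), then all nearby coefficient vectors are loud.  Proof by
contradiction and compactness at the fixed viscosity: non-loud `c_n → c` carry steady weak solutions
`u_n ∈ V` (Temam 1979, Ch. II Thm. 1.2, `exists_mem_energySpaceV_isSteadyWeakSolution`), which are smooth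
(Prop. 1.1, `Torus.Temam1979_steadyWeakSolution_smooth_holds`) and classical with a smooth pressure
(smooth Helmholtz decomposition of the residual, `smooth_helmholtz_holds`), hence — `c_n` being non-loud —
have bad budgets `‖u_n‖² > E ∨ ν‖∇u_n‖² < ε`; the energy equation (`IsSteadyWeakSolution.energy_eq'`) and
Poincaré give a uniform enstrophy bound, Rellich (`isCompact_setOf_eGradNormSq_le`) a limit `u` in `H`,
which is a steady weak solution for `f_c` (continuity of the tested generator,
`continuous_nsGeneratorPairing`) with budgets the limits of those of `u_n`; its classical representative
contradicts the census.  Uses the sibling crux's certified force bookkeeping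
(`Theorems/DenseLoudDesignerForces/Negative`, same `force` by `rfl`).
-/

-- `Summit.<Summit>.<Problem>` is the tree's mandated summit-side namespace (CONVENTIONS §2); for this
-- single-conjunct summit the two coincide, so the duplicate is deliberate.
set_option linter.dupNamespace false

noncomputable section

open scoped BigOperators Topology InnerProductSpace RealInnerProductSpace ENNReal
open Filter Set Function TopologicalSpace MeasureTheory

namespace Summit.AnomalousDissipation.AnomalousDissipation.Theorems.RobustLoudUpgrade.CensusInterior

open Literature.Analysis.FunctionSpaces Literature.Analysis.FunctionSpaces.Torus
open Literature.Analysis.FluidPDE Literature.Analysis.FluidPDE.Torus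
open Summit.AnomalousDissipation.AnomalousDissipation.Theses.BaireTransfer
open Summit.AnomalousDissipation.AnomalousDissipation.Theorems.DenseLoudDesignerForces

/-! ## §1 The force `f_c`: smooth, mean zero, continuous in `c` into `L²` -/

section Force

variable {S : Finset (Fin 3 → ℤ)}

/-- `f_c` is smooth (the sibling crux's `Negative.force` is the same function, `rfl`). [folklore] -/
theorem isSmooth_force (c : Coeff S) : IsSmooth (force S c) := Negative.isSmooth_force S c

/-- `f_c ∈ L²`. [folklore] -/
theorem memLp_force (c : Coeff S) : MemLp (force S c) 2 volume := (isSmooth_force c).memLp 2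

-- pattern from Cruxes/RobustLoudUpgrade/Disproof.lean §2 (`hasZeroMean_force`)
/-- `f_c` has zero mean (its zero Fourier mode is `lerayCoeff 0 _ = 0`). [folklore] -/
theorem hasZeroMean_force (c : Coeff S) : HasZeroMean (force S c) := by
  set g : (Fin 3 → ℤ) → EuclideanSpace ℂ (Fin 3) := fun k => Torus.lerayCoeff k (coeffExt S c k) with hg
  show ∫ x, EuclideanSpace.realPart (trigPoly S g x) = 0
  rw [EuclideanSpace.realPart.integral_comp_comm (continuous_trigPoly S g).integrable_unitAddTorus]
  have h : ∫ x, trigPoly S g x = 0 := by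
    simp_rw [trigPoly_apply]
    rw [integral_finsetSum S (f := fun k x => UnitAddTorus.mFourier k x • g k) fun k _ =>
      ((UnitAddTorus.mFourier k).continuous.smul continuous_const).integrable_unitAddTorus]
    refine Finset.sum_eq_zero fun k _ => ?_
    rw [integral_smul_const, integral_mFourier]
    by_cases hk : k = 0
    · subst hk; simp [hg]
    · simp [hk]
  rw [h, map_zero]

/-- The `L²` class of `f_c` depends continuously on `c` (joint continuity of `(c, x) ↦ f_c(x)` on the
compact torus). [folklore] -/
theorem continuous_toLp_force (S : Finset (Fin 3 → ℤ)) :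
    Continuous fun c : Coeff S => (memLp_force c).toLp (force S c) := by
  set F := fun c : Coeff S => (memLp_force c).toLp (force S c)
  have hj : Continuous (uncurry (force S)) := Negative.continuous_force_uncurry S
  have hnorm : ∀ c₁ c₂ : Coeff S,
      ‖F c₁ - F c₂‖ ^ 2 = ∫ x, ‖force S c₁ x - force S c₂ x‖ ^ 2 := by
    intro c₁ c₂
    rw [← integral_norm_sq_coe_eq]
    refine integral_congr_ae ?_
    filter_upwards [Lp.coeFn_sub (F c₁) (F c₂), (memLp_force c₁).coeFn_toLp,
      (memLp_force c₂).coeFn_toLp] with y h1 h2 h3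
    rw [h1, Pi.sub_apply, h2, h3]
  refine continuous_iff_continuousAt.2 fun c₀ => ?_
  rw [ContinuousAt, tendsto_iff_norm_sub_tendsto_zero]
  have hi : Continuous
      (uncurry fun (c : Coeff S) (y : UnitAddTorus (Fin 3)) => ‖force S c y - force S c₀ y‖ ^ 2) :=
    (hj.sub (hj.comp (continuous_const.prodMk continuous_snd))).norm.pow 2
  have he : Continuous fun c : Coeff S => ∫ y, ‖force S c y - force S c₀ y‖ ^ 2 := by
    simpa only [Measure.restrict_univ] using
      continuous_parametric_integral_of_continuous (μ := (volume : Measure (UnitAddTorus (Fin 3)))) hi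
        isCompact_univ
  have h0 : Tendsto (fun c => ‖F c - F c₀‖ ^ 2) (𝓝 c₀) (𝓝 0) := by
    have h := he.tendsto c₀
    simp_rw [← hnorm] at h
    simpa using h
  have h1 := (Real.continuous_sqrt.tendsto 0).comp h0
  rw [Real.sqrt_zero] at h1
  exact h1.congr fun c => by simp [Real.sqrt_sq (norm_nonneg _)]

end Force

/-! ## §2 Steady weak solutions at smooth mean-zero forcing are classical steady states -/

/-- **Dictionary weak → classical** (Temam 1979, Ch. II Prop. 1.1 with pressure recovery): on `T³`, a
steady weak solution `u ∈ V` of `NS_ν(f)` (`ν > 0`, `f` smooth of zero mean) has a smooth mean-zero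
divergence-free representative `v` and a smooth pressure `p` solving the steady equations classically
(`Torus.IsSteadyNSState`), with `meanEnergy = ‖u‖²_{L²}` and `meanDissipation = ν‖∇u‖² = (u, f)`.  The
pressure is the Helmholtz potential of the smooth residual `f + νΔv − (v·∇)v`, whose solenoidal part
vanishes because the residual is `L²`-orthogonal to smooth solenoidal mean-zero fields (the weak
formulation integrated by parts) and has zero mean. [folklore] -/
theorem exists_isSteadyNSState {f : UnitAddTorus (Fin 3) → EuclideanSpace ℝ (Fin 3)} (hf : IsSmooth f)
    (hf0 : HasZeroMean f) {ν : ℝ} (hν : 0 < ν) {u : energySpace (Fin 3)}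
    (hV : u.1 ∈ energySpaceV (Fin 3)) (hu : IsSteadyWeakSolution ν f u) :
    ∃ (v : UnitAddTorus (Fin 3) → EuclideanSpace ℝ (Fin 3)) (p : UnitAddTorus (Fin 3) → ℝ),
      Torus.IsSteadyNSState ν f v p ∧ HasZeroMean v ∧
      meanEnergy (fun _ : ℝ => v) = ‖u‖ ^ 2 ∧ meanDissipation ν (fun _ : ℝ => v) = pairing u.1 f := by
  obtain ⟨v, hv, hae⟩ :=
    Torus.Temam1979_steadyWeakSolution_smooth_holds (d := Fin 3) (by simp) hν hf hV hu
  have hL2 : MemLp (u.1 : UnitAddTorus (Fin 3) → EuclideanSpace ℝ (Fin 3)) 2 volume := Lp.memLp _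
  -- zero mean and incompressibility of the smooth representative
  have hv0 : HasZeroMean v := by
    unfold HasZeroMean
    rw [← integral_eq_zero_of_mem_energySpace u.2]
    exact integral_congr_ae hae.symm
  have hdiv : IsDivFree v := by
    refine isDivFree_of_sum_mul_mFourierCoeff_eq_zero hv fun k => ?_
    rw [← mFourierCoeff_congr_ae (hae.fun_comp EuclideanSpace.complexify) k]
    exact (isWeaklyDivFree_of_mem_energySpace u.2).sum_mul_mFourierCoeff_eq_zero hL2 k
  -- the smooth residual, orthogonal to smooth solenoidal mean-zero fields, of zero mean
  set R : UnitAddTorus (Fin 3) → EuclideanSpace ℝ (Fin 3) := f + ν • laplacian v - convect v v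
  have hRx : ∀ x, R x = f x + ν • laplacian v x - convect v v x := fun x => rfl
  have hRs : IsSmooth R := (hf.add (hv.laplacian.smul ν)).sub (hv.convect hv)
  have horth : ∀ w : UnitAddTorus (Fin 3) → EuclideanSpace ℝ (Fin 3), IsSmooth w → IsDivFree w →
      HasZeroMean w → ∫ x, ⟪R x, w x⟫_ℝ = 0 := by
    intro w hw hwd hwm
    have h0 := hu w hw hwd hwm
    unfold nsGeneratorPairing inertialPairing at h0
    have e1 : ∫ x, ⟪(u.1 : UnitAddTorus (Fin 3) → EuclideanSpace ℝ (Fin 3)) x, laplacian w x⟫_ℝ =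
        ∫ x, ⟪v x, laplacian w x⟫_ℝ :=
      integral_congr_ae (by filter_upwards [hae] with x hx; rw [hx])
    have e2 : ∫ x, ⟪Torus.fderiv w x ((u.1 : UnitAddTorus (Fin 3) → EuclideanSpace ℝ (Fin 3)) x),
        (u.1 : UnitAddTorus (Fin 3) → EuclideanSpace ℝ (Fin 3)) x⟫_ℝ =
        ∫ x, ⟪convect v w x, v x⟫_ℝ :=
      integral_congr_ae (by filter_upwards [hae] with x hx; rw [hx]; rfl)
    rw [e1, e2, ← integral_inner_laplacian_comm hv hw, integral_inner_convect_eq_neg hv hdiv hw hv] at h0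
    have e3 : ∀ x, ⟪R x, w x⟫_ℝ =
        ⟪f x, w x⟫_ℝ + ν * ⟪laplacian v x, w x⟫_ℝ - ⟪w x, convect v v x⟫_ℝ := fun x => by
      rw [hRx, inner_sub_left, inner_add_left, real_inner_smul_left,
        real_inner_comm (w x) (convect v v x)]
    simp_rw [e3]
    have i1 : Integrable (fun x => ⟪f x, w x⟫_ℝ) volume := (hf.inner hw).integrable
    have i2 : Integrable (fun x => ν * ⟪laplacian v x, w x⟫_ℝ) volume :=
      (hv.laplacian.inner hw).integrable.const_mul ν
    have i3 : Integrable (fun x => ⟪w x, convect v v x⟫_ℝ) volume :=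
      (hw.inner (hv.convect hv)).integrable
    have i12 : Integrable (fun x => ⟪f x, w x⟫_ℝ + ν * ⟪laplacian v x, w x⟫_ℝ) volume := i1.add i2
    rw [integral_sub i12 i3, integral_add i1 i2, integral_const_mul]
    linarith
  have hR0 : HasZeroMean R := by
    show ∫ x, (f x + ν • laplacian v x - convect v v x) = 0
    have i1 : Integrable f volume := hf.integrable
    have i2 : Integrable (fun x => ν • laplacian v x) volume := hv.laplacian.integrable.smul ν
    have i3 : Integrable (fun x => convect v v x) volume := (hv.convect hv).integrable
    have i12 : Integrable (fun x => f x + ν • laplacian v x) volume := i1.add i2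
    rw [integral_sub i12 i3, integral_add i1 i2, integral_smul,
      integral_laplacian_eq_zero_of_isSmooth hv, smul_zero, add_zero,
      integral_convect_self_eq_zero hv hdiv, sub_zero]
    exact hf0
  -- Helmholtz: `R = w₀ + ∇φ`, and `w₀ = 0`
  obtain ⟨w₀, φ, hw₀, hφ, hdiv₀, -, hdec⟩ := smooth_helmholtz_holds (Fin 3) R hRs
  have hw₀m : HasZeroMean w₀ := by
    rw [← hasZeroMean_add_gradient_iff hw₀ hφ, show (fun x => w₀ x + Torus.gradient φ x) = R from
      funext fun x => (hdec x).symm]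
    exact hR0
  have hw₀0 : w₀ = 0 := by
    refine eq_zero_of_integral_norm_sq_nonpos hw₀ (le_of_eq ?_)
    have h1 := horth w₀ hw₀ hdiv₀ hw₀m
    simp_rw [hdec, inner_add_left] at h1
    rw [integral_add (hw₀.inner hw₀).integrable (hφ.gradient.inner hw₀).integrable,
      integral_inner_gradient_eq_zero_of_isDivFree hw₀ hφ hdiv₀, add_zero] at h1
    simpa only [real_inner_self_eq_norm_sq] using h1
  have hmom : ∀ x, R x = Torus.gradient φ x := fun x => by rw [hdec x, hw₀0]; simp
  refine ⟨v, φ, ⟨isSmoothSpaceTimeOn_const hv _, isSmoothSpaceTimeOn_const hφ _, fun t _ x => ?_,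
    fun _ _ => hdiv⟩, hv0, ?_, ?_⟩
  · have h0 : Torus.timeDerivWithin Set.univ (fun _ : ℝ => v) t x = 0 := by
      simp [Torus.timeDerivWithin]
    rw [h0, zero_add, ← hmom x, hRx]
    abel
  · rw [meanEnergy_eq_of_periodic (τ := 1) (fun _ => rfl) one_pos]
    have h1 : ∫ x, ‖v x‖ ^ 2 = ‖u‖ ^ 2 := by
      rw [Submodule.coe_norm, ← integral_norm_sq_coe_eq]
      exact integral_congr_ae (by filter_upwards [hae] with x hx; rw [hx])
    simp [h1]
  · rw [meanDissipation_eq_of_periodic (τ := 1) (fun _ => rfl) one_pos]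
    have h1 : ν * (eGradNormSq v).toReal = pairing u.1 f := by
      rw [← eGradNormSq_congr_ae_field hae]
      exact IsSteadyWeakSolution.energy_eq' (by simp) (hf.memLp 2) hV hu
    simp [h1]

/-- **A priori enstrophy bound** of steady weak solutions `u ∈ V` on `T³`: `‖∇u‖² ≤ (‖f‖₂/ν)²`
(energy equation `ν‖∇u‖² = (u, f) ≤ ‖u‖‖f‖₂` and Poincaré `‖u‖² ≤ ‖∇u‖²` on `H`; Temam 1979, Ch. II
(1.22)). [folklore] -/
theorem eGradNormSq_le_of_isSteadyWeakSolution {f : UnitAddTorus (Fin 3) → EuclideanSpace ℝ (Fin 3)}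
    (hf : MemLp f 2 volume) {ν : ℝ} (hν : 0 < ν) {u : energySpace (Fin 3)}
    (hV : u.1 ∈ energySpaceV (Fin 3)) (hu : IsSteadyWeakSolution ν f u) :
    eGradNormSq (u.1 : UnitAddTorus (Fin 3) → EuclideanSpace ℝ (Fin 3)) ≤
      ENNReal.ofReal ((‖hf.toLp f‖ / ν) ^ 2) := by
  have hfin : eGradNormSq (u.1 : UnitAddTorus (Fin 3) → EuclideanSpace ℝ (Fin 3)) ≠ ⊤ :=
    hV.2.eGradNormSq_lt_top.ne
  set g : ℝ := (eGradNormSq (u.1 : UnitAddTorus (Fin 3) → EuclideanSpace ℝ (Fin 3))).toReal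
  have hg0 : 0 ≤ g := ENNReal.toReal_nonneg
  have he : ν * g = pairing u.1 f := IsSteadyWeakSolution.energy_eq' (by simp) hf hV hu
  have hcs : pairing u.1 f ≤ ‖u‖ * ‖hf.toLp f‖ := (le_abs_self _).trans (abs_pairing_coe_le hf u)
  have hP : ‖u‖ ^ 2 ≤ g := norm_sq_le_of_eGradNormSq_le hfin le_rfl
  have hmain : g ≤ (‖hf.toLp f‖ / ν) ^ 2 := by
    have h1 : (ν * g) ^ 2 ≤ g * ‖hf.toLp f‖ ^ 2 := by
      calc (ν * g) ^ 2 ≤ (‖u‖ * ‖hf.toLp f‖) ^ 2 :=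
            pow_le_pow_left₀ (mul_nonneg hν.le hg0) (by rw [he]; exact hcs) 2
        _ = ‖u‖ ^ 2 * ‖hf.toLp f‖ ^ 2 := by ring
        _ ≤ g * ‖hf.toLp f‖ ^ 2 := mul_le_mul_of_nonneg_right hP (sq_nonneg _)
    rcases eq_or_lt_of_le hg0 with h0 | hpos
    · rw [← h0]; positivity
    · rw [div_pow, le_div_iff₀ (by positivity)]
      nlinarith
  rw [← ENNReal.ofReal_toReal hfin]
  exact ENNReal.ofReal_le_ofReal hmain

/-! ## §3 The stub -/

/-- **Window census ⇒ interior point of `LOUD`** (the registered stub `stub_censusInterior` of the line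
`malkin-cone-group-orbits`): if at one viscosity `ν ∈ (0,a)` every mean-zero classical steady state of
`NS_ν(f_c)` has `meanEnergy < E` and `meanDissipation > ε`, then `c ∈ interior (loud S a E ε)`.  Proof
by contradiction: non-loud `c_n → c` carry classical mean-zero steady states at `ν` (Temam existence +
`exists_isSteadyNSState`) with bad budgets; a uniform enstrophy bound
(`eGradNormSq_le_of_isSteadyWeakSolution`) and Rellich (`isCompact_setOf_eGradNormSq_le`) give a limit
steady weak solution for `f_c` whose budgets are the limits, and whose classical representative
contradicts the census. [folklore] -/
theorem stub_censusInterior : ∀ (S : Finset (Fin 3 → ℤ)) (a E ε : ℝ), censusSteady S a E ε ⊆ interior (loud S a E ε) := by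
  intro S a E ε c hc
  obtain ⟨ν, hν, hνa, hcensus⟩ := hc
  by_contra hnot
  -- non-loud coefficient vectors accumulating at `c`
  have hcl : c ∈ closure (loud S a E ε)ᶜ := by rw [closure_compl]; exact hnot
  obtain ⟨x, hxl, hxc⟩ := mem_closure_iff_seq_limit.1 hcl
  -- the forces in `L²`
  set F := fun c' : Coeff S => (memLp_force c').toLp (force S c')
  have hFx : Tendsto (fun n => F (x n)) atTop (𝓝 (F c)) := ((continuous_toLp_force S).tendsto c).comp hxc
  obtain ⟨M, hM⟩ := ((continuous_norm.tendsto _).comp hFx).bddAbove_range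
  have hM' : ∀ n, ‖F (x n)‖ ≤ M := fun n => hM ⟨n, rfl⟩
  -- steady weak solutions at viscosity `ν`, in a fixed (compact) enstrophy ball of `H`
  choose U hUV hUw using fun n => exists_mem_energySpaceV_isSteadyWeakSolution hν (memLp_force (x n))
  set K : Set (energySpace (Fin 3)) :=
    {w | eGradNormSq (w.1 : UnitAddTorus (Fin 3) → EuclideanSpace ℝ (Fin 3)) ≤
      ENNReal.ofReal ((M / ν) ^ 2)}
  have hKc : IsCompact K := isCompact_setOf_eGradNormSq_le ENNReal.ofReal_ne_top
  have hUK : ∀ n, U n ∈ K := fun n =>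
    (eGradNormSq_le_of_isSteadyWeakSolution (memLp_force (x n)) hν (hUV n) (hUw n)).trans
      (ENNReal.ofReal_le_ofReal (by gcongr; exact hM' n))
  obtain ⟨u, huK, φ, hφ, hlim⟩ := hKc.tendsto_subseq hUK
  have huV : u.1 ∈ energySpaceV (Fin 3) := ⟨u.2, memSobolev_one_complexify_of_eGradNormSq_ne_top
    (Lp.memLp _) (ne_top_of_le_ne_top ENNReal.ofReal_ne_top huK)⟩
  -- the limit is a steady weak solution for `f_c`
  have huw : IsSteadyWeakSolution ν (force S c) u := by
    intro w hw hwd hwm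
    have hA : Tendsto (fun n => nsGeneratorPairing ν (force S c) (U (φ n)) w) atTop
        (𝓝 (nsGeneratorPairing ν (force S c) u w)) :=
      ((continuous_nsGeneratorPairing ν (force S c) hw).tendsto u).comp hlim
    have hB : ∀ m, nsGeneratorPairing ν (force S c) (U m) w =
        (∫ y, ⟪force S c y, w y⟫_ℝ) - ∫ y, ⟪force S (x m) y, w y⟫_ℝ := fun m => by
      have h := hUw m w hw hwd hwm
      unfold nsGeneratorPairing at h ⊢
      linarith
    have hP : Continuous fun c' : Coeff S => ∫ y, ⟪force S c' y, w y⟫_ℝ :=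
      Negative.continuous_pairing S hw.continuous
    have hC : Tendsto (fun n => (∫ y, ⟪force S c y, w y⟫_ℝ) - ∫ y, ⟪force S (x (φ n)) y, w y⟫_ℝ)
        atTop (𝓝 ((∫ y, ⟪force S c y, w y⟫_ℝ) - ∫ y, ⟪force S c y, w y⟫_ℝ)) :=
      tendsto_const_nhds.sub ((hP.tendsto c).comp (hxc.comp hφ.tendsto_atTop))
    rw [sub_self] at hC
    exact tendsto_nhds_unique hA (hC.congr fun n => (hB (φ n)).symm)
  -- its classical representative obeys the census; budgets converge along the subsequence
  obtain ⟨v, p, hst, hv0, hE', hD'⟩ :=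
    exists_isSteadyNSState (isSmooth_force c) (hasZeroMean_force c) hν huV huw
  obtain ⟨hE1, hD1⟩ := hcensus v p hst hv0
  rw [hE'] at hE1
  rw [hD', pairing_eq_inner (memLp_force c)] at hD1
  have h1 : Tendsto (fun n => ‖U (φ n)‖ ^ 2) atTop (𝓝 (‖u‖ ^ 2)) :=
    ((continuous_norm.tendsto u).comp hlim).pow 2
  have h2 : Tendsto (fun n => ⟪(U (φ n)).1, F (x (φ n))⟫_ℝ) atTop (𝓝 ⟪u.1, F c⟫_ℝ) :=
    ((continuous_subtype_val.tendsto u).comp hlim).inner (hFx.comp hφ.tendsto_atTop)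
  obtain ⟨n, hnE, hnD⟩ := ((h1.eventually (gt_mem_nhds hE1)).and (h2.eventually (lt_mem_nhds hD1))).exists
  -- … so `x (φ n)` is loud after all
  obtain ⟨vn, pn, hstn, -, hEn, hDn⟩ :=
    exists_isSteadyNSState (isSmooth_force (x (φ n))) (hasZeroMean_force (x (φ n))) hν (hUV _) (hUw _)
  refine hxl (φ n) ⟨ν, hν, hνa, 1, fun _ => vn, fun _ => pn, one_pos, hstn, fun _ => rfl, ?_, ?_⟩
  · rw [hEn]; exact hnE.le
  · rw [hDn, pairing_eq_inner (memLp_force (x (φ n)))]; exact hnD.le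

end Summit.AnomalousDissipation.AnomalousDissipation.Theorems.RobustLoudUpgrade.CensusInterior

end
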